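import Summits.MatrixMultiplication.OmegaCensus.SmallFormats.GF2FastLeaf
import Summits.MatrixMultiplication.OmegaCensus.SmallFormats.GF2FastTable
import Summits.Ventures.MM22.Rank333.Wang333LPAssembly
import HarnessLib

/-!
# MM22 venture, Route D3-STRETCH — block-indexed mask leaves for the `⟨3,3,3⟩/𝔽₂` LP certificate chain

HONEST FRAMING (cell `pub-mm22`, seat p3 g3). Plumbing, PROVED (0 sorry); no bound is claimed here. The landed LP-DFS data
files (`Wang333LPDfs*.lean`) store each leaf as `MLI N uT rs D` (`Wang333LPAssembly.lean`): rows `(u, y)` refer to the `u`-th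
entry of the orbit's list `uT` of distinct masks, read with `List.getD` — a linear walk (up to 3,683 cons cells for orbit
482) per row, which dominates and, for the big leaves, exhausts the kernel. `MLJ` is the same leaf with the mask read through
64-blocks (`getC?`, `GF2FastLB.lean`); `MLI_eq_MLJ : @MLI = @MLJ` lets a check file rewrite a root tree (after `delta`) into
the block-indexed form before `decide +kernel`, without restating any data.
-/

namespace Summit.Ventures.MM22.GF2Cert

open Summit.MatrixMultiplication.OmegaCensus.GF2RankLB

/-- Mask leaf with an indirection table read through 64-blocks (same value as `MLI`). -/
noncomputable def MLJ (N : ℕ) (uT : List ℕ) (rs : List (ℕ × ℕ)) (D : ℕ) : MCert N :=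
  MCert.leaf (rs.map fun p => ((getC? uT 64 p.1).getD 0, p.2)) D

/-- `MLI = MLJ` (as functions, for `rw`). -/
theorem MLI_eq_MLJ : @MLI = @MLJ := by
  funext N uT rs D
  unfold MLI MLJ
  congr 1
  refine List.map_congr_left fun p _ => ?_
  rw [getC?_eq _ (by decide), List.getD_eq_getElem?_getD]

end Summit.Ventures.MM22.GF2Cert
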